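import Summits.ResolutionOfSingularities.ResolutionOfSingularities.Theorems.ConeExit.Negative.Mirror
import HarnessLib

/-!
# `WildCones.ConeExit` (stmt-ResolutionOfSingularities-16883), line `critical-plane`: stub `stub_gradientOnPlane`

THE GRADIENT DIES ON THE CRITICAL PLANE (polynomial half of the plane-Jacobian dictionary).

Let `G := cone p c` (a form of degree `p` over `κ`, `char κ = p`), `L := Linv p c` its
cone-invariance space (`u ∈ L` iff `G(X + u S) = G(X) + G(u) Sᵖ` in `κ[X₁ … Xₙ, S]`),
`w := update τ i 1 ∈ L`, `ĉ ∈ Kⁿ` a critical point of `G` (`(∂ₖ G)(ĉ) = 0` for all `k`), `ℓ` in the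
`K`-span of `L`, `ĉᵢ = ℓᵢ = 0`. With `P := G(w + X̂) = aeval (j ↦ if j = i then 1 else C τⱼ + Xⱼ) G`
the stub says: for `k ≠ i`, `(∂ₖ P)(ĉ y₀ + ℓ y₁) = 0` in `K[y₀, y₁]`.

Proof (all `MvPolynomial` algebra, nothing about `cone` beyond its homogeneity):
* chain rule (`gradPlane_pderiv_aeval`): `∂ₖ P = (∂ₖ G)(w + X̂)` for `k ≠ i`, and composing the two
  substitutions the goal reads `Q(w + ĉ y₀ + ℓ y₁) = 0` with `Q := ∂ₖ G`, a form of degree `p - 1`;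
* differentiating the defining identity of `u ∈ L` in `Xₖ` kills the `G(u) Sᵖ` term:
  `Q(X + u S) = Q(X)` (`gradPlane_pderiv_translate`), hence `Q(b + s u) = Q(b)` for all points `b`, `s`
  of any `κ`-algebra (`gradPlane_translate_apply`); the set of `v ∈ Kⁿ` with this property is a
  `K`-submodule, so it contains `span_K L ∋ ℓ, w` (`gradPlane_span_translate`);
* peel off `ℓ y₁`, then `w`: the goal becomes `Q(ĉ y₀) = y₀ ^ (p-1) Q(ĉ) = 0`
  (`gradPlane_aeval_mul_of_isHomogeneous` and criticality of `ĉ`).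

Sources: Hironaka, *Additive groups associated with points of a projective space* (1970), Thm 2
(the group scheme `L(a_p)` of translations leaving the tangent cone invariant); the chain rule is
adapted from `Literature.Computability.AlgebraicComplexity.pderiv_aeval_eq_sum`.
-/

noncomputable section

-- single-problem summit: the doubled namespace component `ResolutionOfSingularities` is forced
set_option linter.dupNamespace false

open Summit.ResolutionOfSingularities.ResolutionOfSingularities.Theorems.ConeExit.Negative
  (clean bl ord dv tr step ser pd jac cone Linv dL)
open scoped BigOperators

namespace Summit.ResolutionOfSingularities.ResolutionOfSingularities.Theorems.WildConesConeExit

open MvPolynomial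

/-! ## Generic `MvPolynomial` facts -/

/-- **First-order chain rule** for polynomial substitutions: for `f : σ → R[ι]` and `F ∈ R[σ]`,
`∂ₜ (F ∘ f) = ∑ⱼ ((∂ⱼ F) ∘ f) · ∂ₜ fⱼ`.
(Adapted from `Literature.Computability.AlgebraicComplexity.pderiv_aeval_eq_sum`.) [folklore] -/
theorem gradPlane_pderiv_aeval {R σ ι : Type*} [CommSemiring R] [Fintype σ]
    (f : σ → MvPolynomial ι R) (F : MvPolynomial σ R) (t : ι) :
    pderiv t (aeval f F) = ∑ j, aeval f (pderiv j F) * pderiv t (f j) := by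
  classical
  induction F using MvPolynomial.induction_on with
  | C a => simp [MvPolynomial.algebraMap_eq]
  | add p q hp hq => simp only [map_add, hp, hq, add_mul, Finset.sum_add_distrib]
  | mul_X p j hp =>
      have hX : ∀ s : σ, pderiv s (X j : MvPolynomial σ R) = if s = j then 1 else 0 := fun s => by
        rw [pderiv_X]; simp [Pi.single_apply, eq_comm]
      simp only [map_mul, aeval_X, pderiv_mul, hp, hX, map_add, Finset.sum_add_distrib,
        add_mul]
      congr 1
      · rw [Finset.sum_mul]
        refine Finset.sum_congr rfl fun s _ => ?_
        ring
      · simp [apply_ite, Finset.sum_ite_eq', mul_comm]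

/-- A form of degree `d` is homogeneous of weight `d` under scaling of the substitution:
`F(a • v) = a ^ d • F(v)` in any commutative `R`-algebra. [folklore] -/
theorem gradPlane_aeval_mul_of_isHomogeneous {R σ A : Type*} [CommSemiring R] [CommSemiring A]
    [Algebra R A] {F : MvPolynomial σ R} {d : ℕ} (hF : F.IsHomogeneous d) (a : A) (v : σ → A) :
    aeval (fun j => a * v j) F = a ^ d * aeval v F := by
  classical
  rw [F.as_sum, map_sum, map_sum, Finset.mul_sum]
  refine Finset.sum_congr rfl fun s hs => ?_
  rw [aeval_monomial, aeval_monomial, Finsupp.prod, Finsupp.prod]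
  simp_rw [mul_pow]
  rw [Finset.prod_mul_distrib, Finset.prod_pow_eq_pow_sum, ← hF.degree_eq_sum_deg_support hs]
  ring

/-! ## The cone and its invariance space -/

section Cone

variable {n : ℕ} {κ : Type} [Field κ] (p : ℕ) (c : (Fin n → ℕ) → κ)

/-- The tangent-cone datum `cone p c` is a form of degree `p`. [folklore] -/
theorem gradPlane_cone_isHomogeneous : (cone p c).IsHomogeneous p := by
  unfold cone
  refine IsHomogeneous.sum _ _ _ fun A _ => ?_
  split_ifs with hA
  · refine isHomogeneous_monomial _ ?_
    rw [Finsupp.degree_eq_sum]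
    simpa using hA
  · exact isHomogeneous_zero _ _ _

/-- **Translation invariance of the gradient along `L`.** For `u ∈ L(a_p)` and every `k`,
differentiating `G(X + u S) = G(X) + G(u) Sᵖ` in `Xₖ` gives `(∂ₖ G)(X + u S) = (∂ₖ G)(X)` in
`κ[X₁ … Xₙ, S]` (`S = X none`). [folklore] -/
theorem gradPlane_pderiv_translate {u : Fin n → κ} (hu : u ∈ Linv p c) (k : Fin n) :
    aeval (fun j : Fin n => (X (some j) : MvPolynomial (Option (Fin n)) κ) + C (u j) * X none)
        (pderiv k (cone p c)) = rename some (pderiv k (cone p c)) := by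
  classical
  have h0 : pderiv (some k) (X none : MvPolynomial (Option (Fin n)) κ) = 0 :=
    pderiv_X_of_ne (by simp)
  have hρ : ∀ j : Fin n, pderiv (some k)
      ((X (some j) : MvPolynomial (Option (Fin n)) κ) + C (u j) * X none) =
        if j = k then 1 else 0 := by
    intro j
    rw [map_add, pderiv_C_mul, h0, mul_zero, add_zero, pderiv_X]
    simp [Pi.single_apply]
  have h := congrArg (pderiv (some k)) hu
  rw [gradPlane_pderiv_aeval] at h
  simp_rw [hρ, mul_ite, mul_one, mul_zero, Finset.sum_ite_eq', Finset.mem_univ, if_true] at h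
  rw [h, map_add, pderiv_rename (Option.some_injective _), pderiv_C_mul, pderiv_pow, h0,
    mul_zero, mul_zero, add_zero]

/-- Point form of `gradPlane_pderiv_translate` in any commutative `κ`-algebra `A`:
for `u ∈ L(a_p)`, `(∂ₖ G)(b + s u) = (∂ₖ G)(b)` for all `b ∈ Aⁿ`, `s ∈ A`. [folklore] -/
theorem gradPlane_translate_apply {u : Fin n → κ} (hu : u ∈ Linv p c) (k : Fin n)
    {A : Type*} [CommRing A] [Algebra κ A] (s : A) (b : Fin n → A) :
    aeval (fun j => b j + s * algebraMap κ A (u j)) (pderiv k (cone p c)) =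
      aeval b (pderiv k (cone p c)) := by
  have T := congrArg (aeval (fun o : Option (Fin n) => o.elim s b))
    (gradPlane_pderiv_translate p c hu k)
  rw [comp_aeval_apply, aeval_rename] at T
  have e1 : (fun j => b j + s * algebraMap κ A (u j)) = fun j =>
      aeval (fun o : Option (Fin n) => o.elim s b)
        ((X (some j) : MvPolynomial (Option (Fin n)) κ) + C (u j) * X none) := by
    funext j
    simp only [map_add, map_mul, aeval_X, aeval_C, Option.elim_some, Option.elim_none]
    ring
  have e2 : b = (fun o : Option (Fin n) => o.elim s b) ∘ some := by
    funext j; simp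
  rw [e1, T, ← e2]

/-- **The `K`-span of `L` translates the gradient trivially.** Over an extension field `K` of `κ`
and in any commutative `K`-algebra `A`: for `v ∈ span_K L(a_p)`, `(∂ₖ G)(b + s v) = (∂ₖ G)(b)` for all
`b ∈ Aⁿ`, `s ∈ A` (the set of such `v` is a `K`-submodule containing the image of `L`). [folklore] -/
theorem gradPlane_span_translate (k : Fin n) {K : Type} [Field K] [Algebra κ K]
    {A : Type*} [CommRing A] [Algebra κ A] [Algebra K A] [IsScalarTower κ K A]
    {v : Fin n → K}
    (hv : v ∈ Submodule.span K ((fun (v : Fin n → κ) (k : Fin n) => algebraMap κ K (v k)) '' Linv p c))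
    (s : A) (b : Fin n → A) :
    aeval (fun j => b j + s * algebraMap K A (v j)) (pderiv k (cone p c)) =
      aeval b (pderiv k (cone p c)) := by
  induction hv using Submodule.span_induction generalizing s b with
  | mem v hv =>
      obtain ⟨u, hu, rfl⟩ := hv
      have e : (fun j => b j + s * algebraMap K A (algebraMap κ K (u j))) =
          fun j => b j + s * algebraMap κ A (u j) := by
        funext j; rw [← IsScalarTower.algebraMap_apply]
      rw [e]
      exact gradPlane_translate_apply p c hu k s b
  | zero => simp
  | add v v' _ _ hv hv' =>
      have e : (fun j => b j + s * algebraMap K A ((v + v') j)) =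
          fun j => (b j + s * algebraMap K A (v' j)) + s * algebraMap K A (v j) := by
        funext j; simp only [Pi.add_apply, map_add]; ring
      rw [e, hv s (fun j => b j + s * algebraMap K A (v' j)), hv' s b]
  | smul a v _ hv =>
      have e : (fun j => b j + s * algebraMap K A ((a • v) j)) =
          fun j => b j + (s * algebraMap K A a) * algebraMap K A (v j) := by
        funext j; simp only [Pi.smul_apply, smul_eq_mul, map_mul]; ring
      rw [e, hv (s * algebraMap K A a) b]

end Cone

/-! ## The stub -/

/-- **The gradient of the cone dies on the critical plane** (polynomial form of the plane-Jacobian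
dictionary). With `G = cone p c`, `w = update τ i 1 ∈ L(a_p)`, `ĉ` a critical point of `G` over an
extension field `K`, `ℓ ∈ span_K L(a_p)` and `ĉᵢ = ℓᵢ = 0`: for every `k ≠ i`,
`(∂ₖ G(w + X̂))(ĉ y₀ + ℓ y₁) = 0` in `K[y₀, y₁]`. Indeed `∂ₖ (G(w + X̂)) = (∂ₖ G)(w + X̂)` (chain rule,
`k ≠ i`), `∂ₖ G` is invariant under translation by `span_K L ∋ ℓ y₁, w`, and `(∂ₖ G)(ĉ y₀) =
y₀^{p-1} (∂ₖ G)(ĉ) = 0`. [cite: Hironaka1970AdditiveGroups, Thm 2] -/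
theorem stub_gradientOnPlane : ∀ (p : ℕ), p.Prime → ∀ (n : ℕ) (κ : Type) [Field κ] [CharP κ p] (c : (Fin n → ℕ) → κ) (i : Fin n) (τ : Fin n → κ) (K : Type) [Field K] [Algebra κ K] (ĉ ℓ : Fin n → K), Function.update τ i 1 ∈ Linv p c → (∀ k : Fin n, MvPolynomial.aeval ĉ (MvPolynomial.pderiv k (cone p c)) = 0) → ℓ ∈ Submodule.span K ((fun (v : Fin n → κ) (k : Fin n) => algebraMap κ K (v k)) '' Linv p c) → ĉ i = 0 → ℓ i = 0 → ∀ k : Fin n, k ≠ i → MvPolynomial.aeval (fun j : Fin n => MvPolynomial.C (ĉ j) * MvPolynomial.X (0 : Fin 2) + MvPolynomial.C (ℓ j) * MvPolynomial.X 1) (MvPolynomial.pderiv k (MvPolynomial.aeval (fun j : Fin n => if j = i then (1 : MvPolynomial (Fin n) κ) else MvPolynomial.C (τ j) + MvPolynomial.X j) (cone p c))) = 0 := by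
  intro p _ n κ _ _ c i τ K _ _ ĉ ℓ hw hcrit hℓ hĉi hℓi k hk
  classical
  -- (1) chain rule: `∂ₖ (G(w + X̂)) = (∂ₖ G)(w + X̂)` since `k ≠ i`
  have hσ : ∀ j : Fin n, pderiv k
      (if j = i then (1 : MvPolynomial (Fin n) κ) else C (τ j) + X j) = if j = k then 1 else 0 := by
    intro j
    by_cases hji : j = i
    · rw [if_pos hji, pderiv_one, if_neg (fun hjk => hk (hjk.symm.trans hji))]
    · rw [if_neg hji, map_add, pderiv_C, zero_add, pderiv_X]
      simp [Pi.single_apply]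
  have h1 : pderiv k (aeval (fun j : Fin n => if j = i then (1 : MvPolynomial (Fin n) κ)
      else C (τ j) + X j) (cone p c)) = aeval (fun j : Fin n => if j = i then
      (1 : MvPolynomial (Fin n) κ) else C (τ j) + X j) (pderiv k (cone p c)) := by
    rw [gradPlane_pderiv_aeval]
    simp_rw [hσ, mul_ite, mul_one, mul_zero, Finset.sum_ite_eq', Finset.mem_univ, if_true]
  rw [h1, comp_aeval_apply]
  -- (2) the composed substitution is `j ↦ (ĉⱼ y₀ + wⱼ) + y₁ ℓⱼ`
  have hfun : (fun j : Fin n => aeval (fun j : Fin n => C (ĉ j) * X (0 : Fin 2) + C (ℓ j) * X 1)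
      (if j = i then (1 : MvPolynomial (Fin n) κ) else C (τ j) + X j)) =
      fun j : Fin n => ((C (ĉ j) * X (0 : Fin 2) +
        (1 : MvPolynomial (Fin 2) K) * algebraMap K (MvPolynomial (Fin 2) K)
          (algebraMap κ K (Function.update τ i 1 j))) +
        X 1 * algebraMap K (MvPolynomial (Fin 2) K) (ℓ j)) := by
    funext j
    by_cases hji : j = i
    · subst hji
      simp [hĉi, hℓi]
    · rw [if_neg hji, Function.update_of_ne hji, map_add, aeval_C, aeval_X,
        IsScalarTower.algebraMap_apply κ K (MvPolynomial (Fin 2) K), MvPolynomial.algebraMap_eq]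
      ring
  rw [hfun, gradPlane_span_translate p c k hℓ, gradPlane_span_translate p c k
    (Submodule.subset_span ⟨_, hw, rfl⟩)]
  -- (3) homogeneity: `(∂ₖ G)(ĉ y₀) = y₀ ^ (p - 1) (∂ₖ G)(ĉ) = 0`
  have hQ : (pderiv k (cone p c)).IsHomogeneous (p - 1) := (gradPlane_cone_isHomogeneous p c).pderiv
  have e : (fun j : Fin n => C (ĉ j) * (X (0 : Fin 2) : MvPolynomial (Fin 2) K)) =
      fun j => X 0 * (C ∘ ĉ) j := by
    funext j; exact mul_comm _ _
  rw [e, gradPlane_aeval_mul_of_isHomogeneous hQ, aeval_C_comp_left, hcrit k, map_zero, mul_zero]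

end Summit.ResolutionOfSingularities.ResolutionOfSingularities.Theorems.WildConesConeExit

end
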